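import Literature.NumberTheory.Automorphic.ShimuraCurveCartanLevelHeckeCosets
import Literature.NumberTheory.Automorphic.ShimuraCurveMapDegreeProofs
import Literature.NumberTheory.Automorphic.ShimuraParametrizationSplitCaseConverseProofs
import Literature.NumberTheory.EllipticCurves.ModularParametrizationDegreeProofs
import Mathlib.Analysis.Complex.Cardinality
import HarnessLib

/-!
# Cartan-level Shimura curves: a non-zero weight-two form with lattice periods has a DEGREE — every discriminant `D`,
# including the non-compact modular case `D = 1`

Topic `NumberTheory/Automorphic`. For a Cartan datum `X : CartanLevelCurveData D M C` (tree
`ShimuraCurveCartanLevel.lean`: an order `O` of the indefinite quaternion algebra of discriminant `D`, Eichler of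
level `M` off `C`, non-split Cartan at the primes of `C`; `Γ = X.Gamma = ι(O¹)`), a non-zero `h ∈ S₂(Γ)` whose
periods lie in the lattice `Λ_L` of a period pair `L`, and a base point `τ₀`, there is `d ≥ 1` such that for all
but finitely many classes `c ∈ ℂ ∕ Λ_L` exactly `d` orbits `Γτ` satisfy `∫_{τ₀}^τ h ≡ c (mod Λ_L)`
(`CartanLevelCurveData.exists_deg_of_hasPeriodsIn`). This is "a non-constant holomorphic map of compact Riemann
surfaces `Γ∖ℍ* → ℂ∕Λ_L` has a degree" (Farkas–Kra, Prop. I.1.6), proved on `ℍ`: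

* §1 `exists_deg_of_fiberReduction` — the ABSTRACT count for a properly discontinuous `Γ ≤ GL₂(ℝ)`: if the
  fibres over values near any `w₀` outside finitely many «cusp values» `E + Λ` are `Γ`-equivalent into a compact
  set, and the zeros of `h` lie in finitely many orbits, then the orbit count is finite and locally constant off
  the countable set `(Ψ(zeros) ∪ E) + Λ`, whose complement in `ℂ` is connected (tree
  `finite_and_eventually_natCard_fiberOrbits_eq`, `ShimuraCurveMapDegreeProofs.lean`).
* §2 the Cartan group: proper discontinuity (a subgroup of the hull group `ι(O₀¹)`), FINITE INDEX in the hull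
  group (two hull units congruent modulo `(∏_C q)·O₀ ⊆ O` differ by an element of `O¹`), and for `D > 1`
  COCOMPACTNESS (the hull's closed ball, Vignéras IV Thm. 1.1, translated by the finitely many coset
  representatives) — hence the degree for `D > 1` (`exists_deg_of_hasPeriodsIn_of_one_lt`).
  -- adapted from Summits/BirchSwinnertonDyer/BirchSwinnertonDyer/Theorems/ClassRecordThreeEulerHalvesAtThreeCartanCover{Cocompact,MapDegree}.lean
  -- (cell bsd-stepL, seat tam3-p1 g27: `exists_finset_leftCosets`, `cartanGamma_exists_dist_le_of_one_lt`,
  -- `exists_deg_of_hasPeriodsIn_of_cocompact`), which Literature cannot import; the twins here are the Literature originals' ports.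
* §3 **the modular case `D = 1`** (new): the hull datum `X₀ = X.toShimuraCurveData fd₀ h₀ : ShimuraCurveData 1 M` has
  `ι(O₀) = A·M₀(M)·A⁻¹` with `det A > 0` (tree `ShimuraCurveData.exists_conj_of_discr_one`), whence
  **`A·Γ(M·∏_C q)·A⁻¹ ≤ X.Gamma`** (`conj_mapGL_mem_Gamma`: `γ ≡ 1 (mod M∏q)` gives `ι⁻¹(AγA⁻¹) − 1 ∈ (∏q)·O₀`,
  in `O` by the `saturated` field); reduction theory of the finite-index subgroup `Γ(N') ≤ SL₂(ℤ)` (tree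
  `exists_finset_smul_truncatedFundamentalDomain_cover`: `ℍ = Γ(N')·R·(𝒟_T ∪ {im > T})`) transported by `A`;
  at each translate `A g`, `g ∈ R`, the point `(A g)·∞` is a CUSP of `X.Gamma` (the parabolic
  `A g T^{N'} g⁻¹ A⁻¹ ∈ X.Gamma`), so by Mathlib's `CuspFormClass.zero_at_cusps` the translate
  `φ_g = h ∣[2] (A g)` is a cuspidal `q`-series of period `N'` (`isCuspFunction_slash_conj`); therefore `h` has no
  zeros high in the cusps and finitely many zero orbits (`exists_finite_zeros_of_discr_one`), and
  `Ψ((A g)z) = C_g + (2πi)⁻¹ V_{φ_g}(z)` tends to the cusp value `C_g` uniformly (`segmentIntegral_slash_eq`,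
  `IsCuspFunction.hasDerivAt_verticalIntegral`, `exists_forall_norm_verticalIntegral_le`), so that the fibres
  over values near a `w₀ ∉ {C_g} + Λ` reduce into the compact `⋃_g (A g)·𝒟_T`
  (`exists_eventually_forall_fiber_subset_translate`) — §1 applies (`exists_deg_of_hasPeriodsIn_of_discr_one`).
* §4 `CartanLevelCurveData.exists_deg_of_hasPeriodsIn` for every `D` (`D = 0` is excluded by `Squarefree D`).

This is the analytic input of the print fact `cartanParametrizationData_deg_of_periods_mul`
(`ShimuraCurveCartanLevelHeckeDegree.lean`), discharged there. No new definitions, no facts, no `sorry`.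

## References

* H. M. Farkas, I. Kra, *Riemann Surfaces*, GTM 71 (1992), Prop. I.1.6. [cite: FarkasKra1992, Prop. I.1.6]
* F. Diamond, J. Shurman, *A First Course in Modular Forms*, GTM 228 (2005), Lemma 2.3.1, §2.4, §3.1 (p. 65). [cite: DiamondShurman2005, §2.4 and §3.1 (p. 65)]
* M.-F. Vignéras, *Arithmétique des algèbres de quaternions*, LNM 800 (1980), Ch. IV §1 Thm. 1.1 and exemple 4. [cite: VignerasLNM800, Ch. IV §1 Thm. 1.1]
* D. Kohen, A. Pacetti, *Heegner points on Cartan non-split curves*, Canad. J. Math. 68 (2016), §2 (the groups `Γ_ns(N) ∩ Γ₀(m)` are congruence subgroups). [cite: KohenPacetti2016, §2]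
* H. Pasten, *Shimura curves and the abc conjecture*, J. Number Theory 254 (2024), Prop. 5.1 p. 17 (proof). [cite: PastenShimura2024, Prop. 5.1 p. 17 (proof)]
-/

noncomputable section

open scoped MatrixGroups ModularForm Topology Pointwise
open UpperHalfPlane Filter Set Function

namespace Literature.NumberTheory.Automorphic

open Literature.NumberTheory.EllipticCurves.ModularForms
  (finite_zeros_inter_of_isCompact exists_injOn_and_nhds_le_map IsCuspFunction verticalIntegral
    exists_finset_smul_truncatedFundamentalDomain_cover)

/-! ## §1 The abstract count: degree of `Γ∖ℍ → ℂ∕Λ` from fibre reduction off finitely many cusp values -/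

section Abstract

variable {Γ : Subgroup (GL (Fin 2) ℝ)} [ProperlyDiscontinuousSMul Γ ℍ]

/-- **A non-zero weight-two form with lattice periods has a degree, given fibre reduction off finitely many cusp
values** (Farkas–Kra Prop. I.1.6 argued on `ℍ`): let `Γ ≤ GL₂(ℝ)` act properly discontinuously, `h ∈ S₂(Γ)`
non-zero with periods in `Λ_L`, `Ψ = ∫_{τ₀}^τ h`. Suppose (i) for every base value `w₀` not congruent modulo
`Λ_L` to one of finitely many «cusp values» `E` there is a compact `K ⊆ ℍ` into which the fibres `{Ψ ≡ w}` for
all `w` near `w₀` are `Γ`-equivalent, and (ii) the zeros of `h` are `Γ`-equivalent into a finite set `F₀`. Then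
there is `d ≥ 1` such that all but finitely many classes of `ℂ∕Λ_L` are hit by exactly `d` orbits.
[cite: FarkasKra1992, Prop. I.1.6] -/
theorem exists_deg_of_fiberReduction (h : CuspForm Γ 2) (hh : (⇑h : ℍ → ℂ) ≠ 0) (L : PeriodPair)
    (hper : HasPeriodsIn Γ h (L.lattice : Set ℂ)) (τ₀ : ℍ) {E : Set ℂ} (hE : E.Finite)
    (hred : ∀ w₀ : ℂ, (∀ e ∈ E, w₀ - e ∉ L.lattice) → ∃ K : Set ℍ, IsCompact K ∧
      ∀ᶠ w in 𝓝 w₀, ∀ τ : ℍ, segmentIntegral h τ₀ τ - w ∈ L.lattice → ∃ γ ∈ Γ, γ • τ ∈ K)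
    {F₀ : Set ℍ} (hF₀ : F₀.Finite) (hZ : ∀ τ : ℍ, h τ = 0 → ∃ γ ∈ Γ, γ • τ ∈ F₀) :
    ∃ d : ℕ, 0 < d ∧
      {c : ℂ ⧸ L.lattice.toAddSubgroup |
        Nat.card {y : MulAction.orbitRel.Quotient Γ ℍ // ∃ τ : ℍ,
          (Quotient.mk _ τ : MulAction.orbitRel.Quotient Γ ℍ) = y ∧
            ((segmentIntegral h τ₀ τ : ℂ) : ℂ ⧸ L.lattice.toAddSubgroup) = c} ≠ d}.Finite := by
  classical
  set Ψ : ℍ → ℂ := segmentIntegral h τ₀ with hΨdef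
  set Λ : AddSubgroup ℂ := L.lattice.toAddSubgroup with hΛdef
  have hΛmem : ∀ x : ℂ, x ∈ Λ ↔ x ∈ L.lattice := fun x ↦ Iff.rfl
  -- the lattice `Λ` is closed, discrete and countable
  have hΛc : IsClosed (Λ : Set ℂ) := L.isClosed_lattice
  obtain ⟨r, hr, hrΛ⟩ : ∃ r > 0, ∀ x ∈ Λ, ‖x‖ < r → x = 0 := by
    obtain ⟨ε, hε, hball⟩ := Metric.exists_ball_inter_eq_singleton_of_mem_discrete
      (isDiscrete_iff_discreteTopology.mpr (inferInstance : DiscreteTopology L.lattice))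
      (zero_mem L.lattice)
    refine ⟨ε, hε, fun x hx hxn ↦ ?_⟩
    have : x ∈ Metric.ball (0 : ℂ) ε ∩ (L.lattice : Set ℂ) := ⟨by simpa using hxn, hx⟩
    rw [hball] at this
    exact this
  have hΛcount : (Λ : Set ℂ).Countable := by
    have : Countable L.lattice := Countable.of_equiv _ L.latticeEquivProd.toEquiv.symm
    exact Set.countable_coe_iff.mp this
  -- `Ψ` is `Γ`-equivariant modulo `Λ`, holomorphic with `Ψ' = h`, continuous
  have hΨΓ : ∀ γ ∈ Γ, ∀ τ : ℍ, Ψ (γ • τ) - Ψ τ ∈ Λ := by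
    intro γ hγ τ
    rw [hΨdef, segmentIntegral_sub_segmentIntegral h τ₀ τ (γ • τ)]
    exact hper γ hγ τ
  have hderiv : ∀ z : ℂ, 0 < z.im → HasDerivAt (Ψ ∘ ofComplex) (h (ofComplex z)) z :=
    fun z hz ↦ hasDerivAt_segmentIntegral h τ₀ hz
  have hdiff : DifferentiableOn ℂ (Ψ ∘ ofComplex) {z : ℂ | 0 < z.im} :=
    differentiableOn_segmentIntegral h τ₀
  have hΨc : Continuous Ψ := by
    have h2 : Ψ = (Ψ ∘ ofComplex) ∘ ((↑) : ℍ → ℂ) := by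
      funext τ; simp [ofComplex_apply]
    rw [h2]
    exact hdiff.continuousOn.comp_continuous continuous_coe fun τ ↦ τ.im_pos
  -- local inverse at the non-zeros of `h`
  have hloc : ∀ τ : ℍ, h τ ≠ 0 → (∃ U ∈ 𝓝 τ, InjOn Ψ U) ∧ 𝓝 (Ψ τ) ≤ map Ψ (𝓝 τ) := by
    intro τ hτ
    refine exists_injOn_and_nhds_le_map hdiff (hderiv τ τ.im_pos) ?_
    rwa [ofComplex_apply]
  -- the exceptional set: images of the zero representatives and the cusp values, modulo `Λ`
  set F₁ : Set ℂ := Ψ '' F₀ ∪ E with hF₁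
  have hF₁fin : F₁.Finite := (hF₀.image Ψ).union hE
  set S' : Set ℂ := {w | ∃ x ∈ F₁, w - x ∈ Λ} with hS'
  have hS'count : S'.Countable := by
    have : S' = ⋃ x ∈ F₁, (fun l : ℂ ↦ x + l) '' (Λ : Set ℂ) := by
      ext w
      simp only [hS', mem_setOf_eq, mem_iUnion, mem_image, SetLike.mem_coe, exists_prop]
      constructor
      · rintro ⟨x, hx, hw⟩
        exact ⟨x, hx, w - x, hw, by ring⟩
      · rintro ⟨x, hx, l, hl, rfl⟩
        exact ⟨x, hx, by simpa using hl⟩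
    rw [this]
    exact hF₁fin.countable.biUnion fun x _ ↦ hΛcount.image _
  -- local constancy of the orbit count off `S'`
  have hmain : ∀ w₀, w₀ ∉ S' →
      Finite {y : MulAction.orbitRel.Quotient Γ ℍ //
        ∃ τ : ℍ, Quotient.mk (MulAction.orbitRel Γ ℍ) τ = y ∧ Ψ τ - w₀ ∈ Λ} ∧
      ∀ᶠ w in 𝓝 w₀,
        Nat.card {y : MulAction.orbitRel.Quotient Γ ℍ //
          ∃ τ : ℍ, Quotient.mk (MulAction.orbitRel Γ ℍ) τ = y ∧ Ψ τ - w ∈ Λ} =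
        Nat.card {y : MulAction.orbitRel.Quotient Γ ℍ //
          ∃ τ : ℍ, Quotient.mk (MulAction.orbitRel Γ ℍ) τ = y ∧ Ψ τ - w₀ ∈ Λ} := by
    intro w₀ hw₀
    have hw₀' : ∀ x ∈ F₁, w₀ - x ∉ Λ := fun x hx h ↦ hw₀ ⟨x, hx, h⟩
    obtain ⟨K, hK, hredK⟩ := hred w₀ fun e he ↦ hw₀' e (Or.inr he)
    refine finite_and_eventually_natCard_fiberOrbits_eq hΨc hΛc hr hrΛ hΨΓ hK hredK
      fun τ _ hτ ↦ hloc τ ?_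
    intro hhτ
    obtain ⟨γ, hγ, hγτ⟩ := hZ τ hhτ
    apply hw₀' (Ψ (γ • τ)) (Or.inl ⟨γ • τ, hγτ, rfl⟩)
    -- `w₀ - Ψ(γτ) = -( (Ψ(γτ) - Ψ τ) + (Ψ τ - w₀) )`
    have e : w₀ - Ψ (γ • τ) = -((Ψ (γ • τ) - Ψ τ) + (Ψ τ - w₀)) := by ring
    rw [e]
    exact Λ.neg_mem (Λ.add_mem (hΨΓ γ hγ τ) hτ)
  -- the count as a function, constant on the connected set `S'ᶜ`
  set n : ℂ → ℕ := fun w ↦ Nat.card {y : MulAction.orbitRel.Quotient Γ ℍ //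
      ∃ τ : ℍ, Quotient.mk (MulAction.orbitRel Γ ℍ) τ = y ∧ Ψ τ - w ∈ Λ} with hn
  have hconst : ∀ w ∈ S'ᶜ, ∀ w' ∈ S'ᶜ, n w = n w' := by
    have hconn : IsConnected S'ᶜ :=
      hS'count.isConnected_compl_of_one_lt_rank (by rw [Complex.rank_real_complex]; norm_num)
    haveI := Subtype.preconnectedSpace hconn.isPreconnected
    have hlc : IsLocallyConstant (fun x : ↥(S'ᶜ) ↦ n x) := by
      refine (IsLocallyConstant.iff_eventually_eq _).mpr fun x ↦ ?_
      exact continuous_subtype_val.continuousAt.eventually (hmain x.1 x.2).2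
    intro w hw w' hw'
    have h := congr_fun (hlc.eq_const ⟨w, hw⟩) ⟨w', hw'⟩
    simp only [const_apply] at h
    exact h.symm
  -- a base point `w₁ ∉ S'` in the image of `Ψ`: there `n w₁ ≥ 1`
  obtain ⟨τ₁, hτ₁⟩ : ∃ τ₁ : ℍ, h τ₁ ≠ 0 := by
    by_contra hc
    simp only [not_exists, not_not] at hc
    exact hh (funext hc)
  obtain ⟨w₁, hw₁S, σ₁, -, hσ₁⟩ : (S'ᶜ ∩ Ψ '' univ).Nonempty :=
    (hS'count.dense_compl ℝ).inter_nhds_nonempty ((hloc τ₁ hτ₁).2 (image_mem_map univ_mem))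
  have hd : 0 < n w₁ := by
    haveI := (hmain w₁ hw₁S).1
    refine Nat.card_pos_iff.mpr ⟨⟨⟨Quotient.mk _ σ₁, σ₁, rfl, ?_⟩⟩, inferInstance⟩
    simp [hσ₁, Λ.zero_mem]
  -- conclusion
  refine ⟨n w₁, hd, (hF₁fin.image (QuotientAddGroup.mk : ℂ → ℂ ⧸ Λ)).subset ?_⟩
  intro P hP
  by_contra hPF
  obtain ⟨w, rfl⟩ := QuotientAddGroup.mk_surjective P
  have hwS : w ∈ S'ᶜ := by
    rintro ⟨x, hx, hwx⟩
    exact hPF ⟨x, hx, (QuotientAddGroup.eq_iff_sub_mem.mpr hwx).symm⟩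
  apply hP
  rw [← hconst w hwS w₁ hw₁S, hn]
  refine Nat.card_congr (Equiv.subtypeEquivRight fun y ↦ ?_)
  simp only [QuotientAddGroup.eq_iff_sub_mem]

omit [ProperlyDiscontinuousSMul Γ ℍ] in
/-- The zero set of a slash-invariant form is invariant: `f(γz) = 0 ↔ f(z) = 0` for `γ ∈ Γ` with `det γ > 0`
(`(f ∣[k] γ)(z) = f(γz)·det^{k-1}·j(γ,z)^{-k}` and `f ∣[k] γ = f`). [folklore] -/
private theorem cuspForm_apply_smul_eq_zero_iff {k : ℤ} (f : CuspForm Γ k) {γ : GL (Fin 2) ℝ} (hγ : γ ∈ Γ)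
    (hdet : 0 < γ.det.val) (z : ℍ) : f (γ • z) = 0 ↔ f z = 0 := by
  have h1 : (⇑f : ℍ → ℂ) ∣[k] γ = ⇑f := SlashInvariantFormClass.slash_action_eq f γ hγ
  have h2 := congr_fun h1 z
  rw [ModularForm.slash_apply, σ_apply_of_det_pos hdet, abs_of_pos hdet] at h2
  have hd : (denom γ z) ^ (-k) ≠ 0 := zpow_ne_zero _ (denom_ne_zero γ z)
  have hD : ((γ.det.val : ℝ) : ℂ) ^ (k - 1) ≠ 0 := zpow_ne_zero _ (by exact_mod_cast hdet.ne')
  constructor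
  · intro h; rw [h, zero_mul, zero_mul] at h2; exact h2.symm
  · intro h; rw [h] at h2
    rcases mul_eq_zero.mp h2 with h3 | h3
    · rcases mul_eq_zero.mp h3 with h4 | h4
      · exact h4
      · exact absurd h4 hD
    · exact absurd h3 hd

omit [ProperlyDiscontinuousSMul Γ ℍ] in
/-- A `GL₂(ℝ)`-translate `f ∣[k] g` of a non-zero function is non-zero (`f = (f ∣[k] g) ∣[k] g⁻¹`). [folklore] -/
private theorem slash_ne_zero_of_ne_zero {k : ℤ} {f : ℍ → ℂ} (hf : f ≠ 0) (g : GL (Fin 2) ℝ) : f ∣[k] g ≠ 0 := by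
  intro h
  apply hf
  have : f = (f ∣[k] g) ∣[k] g⁻¹ := by
    rw [← SlashAction.slash_mul, mul_inv_cancel, SlashAction.slash_one]
  rw [this, h, SlashAction.zero_slash]

omit [ProperlyDiscontinuousSMul Γ ℍ] in
/-- `(f ∣[k] g)(z) = 0 ↔ f(g z) = 0` for `det g > 0`. [folklore] -/
private theorem slash_apply_eq_zero_iff {k : ℤ} (f : ℍ → ℂ) {g : GL (Fin 2) ℝ} (hdet : 0 < g.det.val) (z : ℍ) :
    (f ∣[k] g) z = 0 ↔ f (g • z) = 0 := by
  rw [ModularForm.slash_apply, σ_apply_of_det_pos hdet, abs_of_pos hdet]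
  have hd : (denom g z) ^ (-k) ≠ 0 := zpow_ne_zero _ (denom_ne_zero g z)
  have hD : ((g.det.val : ℝ) : ℂ) ^ (k - 1) ≠ 0 := zpow_ne_zero _ (by exact_mod_cast hdet.ne')
  rw [mul_assoc, mul_eq_zero, or_iff_left (mul_ne_zero hD hd)]

end Abstract

/-- **Fibres off the cusp values reduce into a compact set** (translate form of the tree's
`exists_eventually_forall_fiber_subset`, `ModularParametrizationDegreeProofs.lean`): suppose every `τ ∈ ℍ` is
`τ = γ (t g) z` with `γ ∈ Γ`, `g` in a finite `R`, and `z` in the truncated fundamental domain `𝒟_T` or of height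
`> T`, for every `T`; that `Ψ` is `Γ`-equivariant modulo the closed subgroup `Λ`; and that `Ψ((t g) z) → C_g` as
`im z → ∞`, uniformly, for `g ∈ R`. If `w₀` is not congruent to any `C_g`, then for some `T` and all `w` near
`w₀` every point of the fibre `{Ψ ≡ w}` is `Γ`-equivalent into the compact `⋃_{g ∈ R} (t g)·𝒟_T`
(Diamond–Shurman §2.4: neighbourhoods of the cusps). [cite: DiamondShurman2005, §2.4] -/
theorem exists_eventually_forall_fiber_subset_translate {Γ : Subgroup (GL (Fin 2) ℝ)} {Ψ : ℍ → ℂ}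
    {Λ : AddSubgroup ℂ} (R : Finset SL(2, ℤ)) (t : SL(2, ℤ) → GL (Fin 2) ℝ)
    (hR : ∀ (T : ℝ) (τ : ℍ), ∃ γ ∈ Γ, ∃ g ∈ R, ∃ z : ℍ, τ = γ • t g • z ∧
      (z ∈ ModularGroup.truncatedFundamentalDomain T ∨ T < z.im))
    (hΨΓ : ∀ γ ∈ Γ, ∀ τ : ℍ, Ψ (γ • τ) - Ψ τ ∈ Λ) (hΛc : IsClosed (Λ : Set ℂ))
    (Cv : SL(2, ℤ) → ℂ) (hC : ∀ ε > 0, ∃ T : ℝ, ∀ g ∈ R, ∀ z : ℍ, T ≤ z.im → ‖Ψ (t g • z) - Cv g‖ < ε)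
    {w₀ : ℂ} (hw₀ : ∀ g ∈ R, Cv g - w₀ ∉ Λ) :
    ∃ T : ℝ, ∀ᶠ w in 𝓝 w₀, ∀ τ : ℍ, Ψ τ - w ∈ Λ → ∃ γ ∈ Γ,
      γ • τ ∈ ⋃ g ∈ R, (fun z : ℍ => t g • z) '' ModularGroup.truncatedFundamentalDomain T := by
  have hδ : ∀ g ∈ R, ∀ᶠ δ in 𝓝[>] (0 : ℝ), Metric.ball (Cv g - w₀) δ ⊆ (Λ : Set ℂ)ᶜ := by
    intro g hg
    obtain ⟨δ, hδ, hball⟩ := Metric.isOpen_iff.mp hΛc.isOpen_compl (Cv g - w₀) (hw₀ g hg)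
    filter_upwards [Ioo_mem_nhdsGT hδ] with δ' hδ'
    exact (Metric.ball_subset_ball hδ'.2.le).trans hball
  obtain ⟨δ, hδ, (hδ0 : 0 < δ)⟩ := (((R.eventually_all).mpr hδ).and self_mem_nhdsWithin).exists
  obtain ⟨T, hT⟩ := hC (δ / 2) (by positivity)
  refine ⟨T, ?_⟩
  filter_upwards [Metric.ball_mem_nhds w₀ (show 0 < δ / 2 by positivity)] with w hw τ hτ
  obtain ⟨γ, hγ, g, hg, z, rfl, hz⟩ := hR T τ
  have hgz : Ψ (t g • z) - w ∈ Λ := by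
    simpa using Λ.sub_mem hτ (hΨΓ γ hγ (t g • z))
  rcases hz with hz | hz
  · refine ⟨γ⁻¹, inv_mem hγ, ?_⟩
    rw [smul_smul, inv_mul_cancel, one_smul]
    exact mem_iUnion₂.mpr ⟨g, hg, z, hz, rfl⟩
  · exfalso
    refine hδ g hg ?_ hgz
    rw [Metric.mem_ball, dist_eq_norm]
    calc ‖Ψ (t g • z) - w - (Cv g - w₀)‖ = ‖(Ψ (t g • z) - Cv g) + (w₀ - w)‖ := by ring_nf
      _ ≤ ‖Ψ (t g • z) - Cv g‖ + ‖w₀ - w‖ := norm_add_le _ _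
      _ < δ / 2 + δ / 2 := by
        gcongr
        · exact hT g hg z hz.le
        · rwa [← dist_eq_norm, dist_comm]
      _ = δ := by ring

/-! ## §2 The Cartan-level group: proper discontinuity, finite index in the hull group, cocompactness for `D > 1` -/

namespace CartanLevelCurveData

variable {D M : ℕ} {C : Finset ℕ} (X : CartanLevelCurveData D M C)

/-- **`X.Gamma` acts properly discontinuously on `ℍ`** (a subgroup of the hull group `ι(O₀¹)`, which does:
tree `ShimuraCurveData.properlyDiscontinuousSMul_Gamma` for `X.toShimuraCurveData`). [cite: VignerasLNM800, Ch. IV §1 Thm. 1.1] -/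
theorem properlyDiscontinuousSMul_Gamma : ProperlyDiscontinuousSMul X.Gamma ℍ := by
  obtain ⟨fd₀, h₀⟩ := X.exists_isHypFundamentalDomain_hull
  have hH : ProperlyDiscontinuousSMul (X.toShimuraCurveData fd₀ h₀).Gamma ℍ :=
    (X.toShimuraCurveData fd₀ h₀).properlyDiscontinuousSMul_Gamma
  rw [Subgroup.properlyDiscontinuousSMul_iff] at hH ⊢
  intro K L hK hL
  refine (hH hK hL).subset ?_
  rintro γ ⟨hγ, hKL⟩
  exact ⟨X.gamma_le_normOneUnits_hull hγ, hKL⟩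

/-- The product of the Cartan primes is non-zero. [folklore] -/
private theorem prod_cartanPrimes_ne_zero (X : CartanLevelCurveData D M C) : (∏ q ∈ C, q : ℕ) ≠ 0 :=
  Finset.prod_ne_zero_iff.mpr fun q hq => (X.coprime q hq).1.ne_zero

/-- **Finite index of `X.Gamma` in the hull group**: finitely many hull units `γ_v ∈ ι(O₀¹)` with
`ι(O₀¹) = ⋃_v γ_v·X.Gamma`. Two norm-one units `u, u'` of `O₀` with the same image in `O₀ ∕ N·O₀` (`N = ∏_C q`;
coordinates modulo `N` in a `ℤ`-basis of `O₀`) satisfy `u⁻¹u' − 1 = u⁻¹(u' − u) ∈ N·O₀ ⊆ O` (field `smul_mem`),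
so `u⁻¹u' ∈ O¹`.
-- adapted from Summits/…/ClassRecordThreeEulerHalvesAtThreeCartanCoverCocompact.lean (`exists_finset_leftCosets`, tam3-p1 g27)
[cite: KohenPacetti2016, §2] -/
theorem exists_finset_leftCosets :
    ∃ T : Finset (GL (Fin 2) ℝ), (∀ t ∈ T, t ∈ normOneUnits X.ι X.isEichlerOrder.isOrder) ∧
      ∀ γ ∈ normOneUnits X.ι X.isEichlerOrder.isOrder, ∃ t ∈ T, t⁻¹ * γ ∈ X.Gamma := by
  classical
  have hO₀ := X.isEichlerOrder.isOrder
  set N : ℕ := ∏ q ∈ C, q with hNdef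
  have hN : N ≠ 0 := X.prod_cartanPrimes_ne_zero
  haveI : NeZero N := ⟨hN⟩
  obtain ⟨b⟩ := hO₀.isFullLattice.nonempty_basis_fin_four
  let coord : X.O₀ → (Fin 4 → ZMod N) := fun x i => ((b.repr x i : ℤ) : ZMod N)
  have hcoord : ∀ x y : X.O₀, coord x = coord y → ∃ z : X.O₀, (x : X.B) - y = (N : ℤ) • (z : X.B) := by
    intro x y hxy
    have hdiv : ∀ i, (N : ℤ) ∣ b.repr x i - b.repr y i := by
      intro i
      have h := congr_fun hxy i
      exact (ZMod.intCast_eq_intCast_iff_dvd_sub _ _ _).mp h.symm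
    choose c hc using hdiv
    refine ⟨Finsupp.linearCombination ℤ b (Finsupp.equivFunOnFinite.symm c), ?_⟩
    have hrepr : b.repr (x - y) = (N : ℤ) • Finsupp.equivFunOnFinite.symm c := by
      ext i
      simp [hc i]
    have hxmy : x - y = (N : ℤ) • Finsupp.linearCombination ℤ b (Finsupp.equivFunOnFinite.symm c) := by
      apply b.repr.injective
      rw [hrepr, map_zsmul, b.repr_linearCombination]
    have := congrArg (fun v : X.O₀ => (v : X.B)) hxmy
    simpa using this
  have hlift : ∀ γ ∈ normOneUnits X.ι X.isEichlerOrder.isOrder,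
      ∃ u : X.O₀, X.ι (u : X.B) = (γ : Matrix (Fin 2) (Fin 2) ℝ) := by
    rintro γ ⟨⟨x, hx, hxγ⟩, -, -⟩
    exact ⟨⟨x, hx⟩, hxγ⟩
  choose! lift hliftι using hlift
  have hfin : (Set.range fun γ : normOneUnits X.ι X.isEichlerOrder.isOrder => coord (lift γ)).Finite :=
    Set.toFinite _
  have hrep : ∀ v ∈ Set.range (fun γ : normOneUnits X.ι X.isEichlerOrder.isOrder => coord (lift γ)),
      ∃ t : GL (Fin 2) ℝ, t ∈ normOneUnits X.ι X.isEichlerOrder.isOrder ∧ coord (lift t) = v := by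
    rintro v ⟨γ, rfl⟩
    exact ⟨γ, γ.2, rfl⟩
  choose! rep hrepmem hrepcoord using hrep
  refine ⟨hfin.toFinset.image rep, ?_, ?_⟩
  · intro t ht
    obtain ⟨v, hv, rfl⟩ := Finset.mem_image.mp ht
    exact hrepmem v (hfin.mem_toFinset.mp hv)
  · intro γ hγ
    set v := coord (lift γ) with hvdef
    have hv : v ∈ Set.range (fun γ : normOneUnits X.ι X.isEichlerOrder.isOrder => coord (lift γ)) :=
      ⟨⟨γ, hγ⟩, rfl⟩
    refine ⟨rep v, Finset.mem_image.mpr ⟨v, hfin.mem_toFinset.mpr hv, rfl⟩, ?_⟩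
    have ht := hrepmem v hv
    have hc : coord (lift (rep v)) = coord (lift γ) := by rw [hrepcoord v hv]
    obtain ⟨z, hz⟩ := hcoord _ _ hc
    obtain ⟨⟨xt, hxt, hxtι⟩, ⟨yt, hyt, hytι⟩, hdet_t⟩ := ht
    obtain ⟨⟨xγ, hxγ, hxγι⟩, ⟨yγ, hyγ, hyγι⟩, hdet_γ⟩ := hγ
    have hut : (lift (rep v) : X.B) = xt :=
      X.ι_injective (by rw [hliftι _ ⟨⟨xt, hxt, hxtι⟩, ⟨yt, hyt, hytι⟩, hdet_t⟩, hxtι])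
    have huγ : (lift γ : X.B) = xγ :=
      X.ι_injective (by rw [hliftι _ ⟨⟨xγ, hxγ, hxγι⟩, ⟨yγ, hyγ, hyγι⟩, hdet_γ⟩, hxγι])
    have hyx : yt * xt = 1 :=
      X.ι_injective (by rw [map_mul, hytι, hxtι, ← Units.val_mul, inv_mul_cancel, Units.val_one, map_one])
    have hmemO : yt * xγ ∈ X.O := by
      have e : yt * xγ = 1 + (-(yt * ((N : ℤ) • (z : X.B)))) := by
        have : (xt : X.B) - xγ = (N : ℤ) • (z : X.B) := by rw [← hut, ← huγ]; exact hz
        calc yt * xγ = yt * xt - yt * (xt - xγ) := by noncomm_ring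
          _ = 1 + (-(yt * ((N : ℤ) • (z : X.B)))) := by rw [hyx, this]; abel
      rw [e]
      refine X.O.add_mem X.isOrder.one_mem (X.O.neg_mem ?_)
      rw [mul_smul_comm]
      exact X.smul_mem _ (hO₀.mul_mem yt hyt _ z.2)
    have hmemO' : yγ * xt ∈ X.O := by
      have hyγx : yγ * xγ = 1 :=
        X.ι_injective (by rw [map_mul, hyγι, hxγι, ← Units.val_mul, inv_mul_cancel, Units.val_one, map_one])
      have e : yγ * xt = 1 + yγ * ((N : ℤ) • (z : X.B)) := by
        have : (xt : X.B) - xγ = (N : ℤ) • (z : X.B) := by rw [← hut, ← huγ]; exact hz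
        calc yγ * xt = yγ * xγ + yγ * (xt - xγ) := by noncomm_ring
          _ = 1 + yγ * ((N : ℤ) • (z : X.B)) := by rw [hyγx, this]
      rw [e]
      refine X.O.add_mem X.isOrder.one_mem ?_
      rw [mul_smul_comm]
      exact X.smul_mem _ (hO₀.mul_mem yγ hyγ _ z.2)
    refine ⟨⟨yt * xγ, hmemO, by rw [map_mul, hytι, hxγι, Units.val_mul]⟩, ⟨yγ * xt, hmemO', ?_⟩, ?_⟩
    · rw [map_mul, hyγι, hxtι, mul_inv_rev, inv_inv, Units.val_mul]
    · rw [map_mul, map_inv, hdet_t, hdet_γ, inv_one, one_mul]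

/-- **Cocompactness for `D > 1`**: one compact set (the hull's closed ball, translated by the inverses of the coset
representatives) meets every `X.Gamma`-orbit.
-- adapted from Summits/…/ClassRecordThreeEulerHalvesAtThreeCartanCoverCocompact.lean (`cartanGamma_exists_dist_le_of_one_lt`, tam3-p1 g27)
[cite: VignerasLNM800, Ch. IV §1 Thm. 1.1] -/
theorem exists_isCompact_forall_exists_smul_mem_of_one_lt (hD : 1 < D) :
    ∃ K : Set ℍ, IsCompact K ∧ ∀ z : ℍ, ∃ γ ∈ X.Gamma, γ • z ∈ K := by
  classical
  obtain ⟨fd₀, h₀⟩ := X.exists_isHypFundamentalDomain_hull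
  obtain ⟨ρ₀, hρ₀⟩ := (X.toShimuraCurveData fd₀ h₀).exists_forall_exists_smul_mem_closedBall hD
  obtain ⟨T, -, hcos⟩ := X.exists_finset_leftCosets
  refine ⟨⋃ t ∈ T, (fun z : ℍ => t⁻¹ • z) '' Metric.closedBall UpperHalfPlane.I ρ₀,
    T.isCompact_biUnion fun t _ => (isCompact_closedBall _ _).image (continuous_const_smul _), fun z => ?_⟩
  obtain ⟨γ₀, hγ₀, hz⟩ := hρ₀ z
  obtain ⟨t, ht, htγ⟩ := hcos γ₀ hγ₀
  refine ⟨t⁻¹ * γ₀, htγ, mem_iUnion₂.mpr ⟨t, ht, γ₀ • z, hz, ?_⟩⟩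
  rw [mul_smul]

/-- **Degree of a non-zero weight-two form on a Cartan-level curve, `D > 1`** (cocompact case of §1: no cusp values,
one compact set for all fibres, the zeros in it a finite set). [cite: FarkasKra1992, Prop. I.1.6] -/
theorem exists_deg_of_hasPeriodsIn_of_one_lt (hD : 1 < D) (h : CuspForm X.Gamma 2) (hh : (⇑h : ℍ → ℂ) ≠ 0)
    (L : PeriodPair) (hper : HasPeriodsIn X.Gamma h (L.lattice : Set ℂ)) (τ₀ : ℍ) :
    ∃ d : ℕ, 0 < d ∧
      {c : ℂ ⧸ L.lattice.toAddSubgroup |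
        Nat.card {y : MulAction.orbitRel.Quotient X.Gamma ℍ // ∃ τ : ℍ,
          (Quotient.mk _ τ : MulAction.orbitRel.Quotient X.Gamma ℍ) = y ∧
            ((segmentIntegral h τ₀ τ : ℂ) : ℂ ⧸ L.lattice.toAddSubgroup) = c} ≠ d}.Finite := by
  haveI := X.properlyDiscontinuousSMul_Gamma
  obtain ⟨K, hK, hKcov⟩ := X.exists_isCompact_forall_exists_smul_mem_of_one_lt hD
  have hZfin : ({τ : ℍ | h τ = 0} ∩ K).Finite := finite_zeros_inter_of_isCompact (CuspFormClass.holo h) hh hK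
  refine exists_deg_of_fiberReduction h hh L hper τ₀ Set.finite_empty
    (fun w₀ _ => ⟨K, hK, Filter.Eventually.of_forall fun w τ _ => hKcov τ⟩) hZfin fun τ hτ => ?_
  obtain ⟨γ, hγ, hγτ⟩ := hKcov τ
  refine ⟨γ, hγ, ?_, hγτ⟩
  have hdet : 0 < γ.det.val := by
    rw [Subgroup.HasDetOne.det_eq hγ]; exact one_pos
  exact (cuspForm_apply_smul_eq_zero_iff h hγ hdet τ).mpr hτ

end CartanLevelCurveData

/-! ## §3 The modular case `D = 1`: a principal congruence subgroup inside `X.Gamma`; cusps; cusp functions; reduction -/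

namespace CartanLevelCurveData

variable {M : ℕ} {C : Finset ℕ} (X : CartanLevelCurveData 1 M C)

/-- **`ι(O) ⊇ A·Γ(M·∏_C q)·A⁻¹` at the level of the order** (`D = 1`): with the conjugator `A` (`det A > 0`) of the
hull datum, `ι(O₀) = A·M₀(M)·A⁻¹` (tree `ShimuraCurveData.exists_conj_of_discr_one`), every `γ ∈ SL₂(ℤ)` with
`γ ≡ 1 (mod M·∏_C q)` has `AγA⁻¹ = ι(x)` for some `x ∈ O`: `x ∈ O₀` and `x − 1 ∈ (∏_C q)·O₀`, so `x ∈ O` by the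
`saturated` field of the datum (the Cartan order contains `ℤ + q O₀` locally at each `q ∈ C`).
[cite: KohenPacetti2016, §2] [cite: VignerasLNM800, Ch. IV §1 exemple 4 (groupes de congruence)] -/
theorem exists_conj_principal_of_discr_one :
    0 < M ∧ ∃ A : GL (Fin 2) ℝ, 0 < A.det.val ∧
      ∀ γ : SL(2, ℤ), γ ∈ CongruenceSubgroup.Gamma (M * ∏ q ∈ C, q) →
        ∃ x ∈ X.O, X.ι x = (A : Matrix (Fin 2) (Fin 2) ℝ) *
          ((γ : Matrix (Fin 2) (Fin 2) ℤ).map (Int.cast : ℤ → ℝ)) * ((A⁻¹ : GL (Fin 2) ℝ) : Matrix (Fin 2) (Fin 2) ℝ) := by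
  obtain ⟨fd₀, h₀⟩ := X.exists_isHypFundamentalDomain_hull
  obtain ⟨hM, A, hA, H⟩ := (X.toShimuraCurveData fd₀ h₀).exists_conj_of_discr_one
  refine ⟨hM, A, hA, fun γ hγ => ?_⟩
  set N : ℕ := ∏ q ∈ C, q with hNdef
  have hN : N ≠ 0 := X.prod_cartanPrimes_ne_zero
  -- the entries of `γ` modulo `M N`
  rw [CongruenceSubgroup.Gamma_mem] at hγ
  obtain ⟨h00, h01, h10, h11⟩ := hγ
  have hdvd : ∀ (a : ℤ), ((a : ℤ) : ZMod (M * N)) = 0 → ∃ e : ℤ, a = ((M * N : ℕ) : ℤ) * e := fun a ha =>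
    (ZMod.intCast_zmod_eq_zero_iff_dvd a (M * N)).mp ha
  obtain ⟨e00, he00⟩ := hdvd ((γ : Matrix (Fin 2) (Fin 2) ℤ) 0 0 - 1) (by push_cast; rw [h00, sub_self])
  obtain ⟨e01, he01⟩ := hdvd ((γ : Matrix (Fin 2) (Fin 2) ℤ) 0 1) h01
  obtain ⟨e10, he10⟩ := hdvd ((γ : Matrix (Fin 2) (Fin 2) ℤ) 1 0) h10
  obtain ⟨e11, he11⟩ := hdvd ((γ : Matrix (Fin 2) (Fin 2) ℤ) 1 1 - 1) (by push_cast; rw [h11, sub_self])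
  set E : Matrix (Fin 2) (Fin 2) ℤ := !![e00, e01; e10, e11] with hEdef
  have hγE : (γ : Matrix (Fin 2) (Fin 2) ℤ) = 1 + ((M * N : ℕ) : ℤ) • E := by
    ext i j
    fin_cases i <;> fin_cases j
    · simp only [hEdef, Matrix.add_apply, Matrix.one_apply_eq, Matrix.smul_apply, smul_eq_mul,
        Matrix.of_apply, Matrix.cons_val', Matrix.cons_val_zero, Matrix.cons_val_fin_one, Fin.zero_eta, Fin.isValue]
      linear_combination he00
    · simp only [hEdef, Matrix.add_apply, Matrix.smul_apply, smul_eq_mul, Matrix.of_apply, Matrix.cons_val',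
        Matrix.cons_val_zero, Matrix.cons_val_one, Matrix.cons_val_fin_one, Fin.zero_eta, Fin.mk_one, Fin.isValue,
        Matrix.one_apply_ne (show (0 : Fin 2) ≠ 1 by decide)]
      linear_combination he01
    · simp only [hEdef, Matrix.add_apply, Matrix.smul_apply, smul_eq_mul, Matrix.of_apply, Matrix.cons_val',
        Matrix.cons_val_zero, Matrix.cons_val_one, Matrix.cons_val_fin_one, Fin.zero_eta, Fin.mk_one, Fin.isValue,
        Matrix.one_apply_ne (show (1 : Fin 2) ≠ 0 by decide)]
      linear_combination he10
    · simp only [hEdef, Matrix.add_apply, Matrix.one_apply_eq, Matrix.smul_apply, smul_eq_mul,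
        Matrix.of_apply, Matrix.cons_val', Matrix.cons_val_one, Matrix.cons_val_fin_one, Fin.mk_one, Fin.isValue]
      linear_combination he11
  -- `x₀ ∈ O₀` with `ι x₀ = A γ A⁻¹`
  have hMγ : (M : ℤ) ∣ (γ : Matrix (Fin 2) (Fin 2) ℤ) 1 0 := ⟨(N : ℤ) * e10, by rw [he10]; push_cast; ring⟩
  obtain ⟨x₀, hx₀, hx₀ι⟩ := (H _).mpr ⟨(γ : Matrix (Fin 2) (Fin 2) ℤ), hMγ, rfl⟩
  change x₀ ∈ X.O₀ at hx₀
  change X.ι x₀ = _ at hx₀ι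
  refine ⟨x₀, X.saturated x₀ hx₀ fun q hq => ?_, hx₀ι⟩
  -- at `q ∈ C`: `x₀ - 1 = q • y` with `ι y = A (M (N/q) E) A⁻¹`, `y ∈ O₀`
  have hqN : q ∣ N := Finset.dvd_prod_of_mem _ hq
  set Eq : Matrix (Fin 2) (Fin 2) ℤ := ((M * (N / q) : ℕ) : ℤ) • E with hEqdef
  have hMEq : (M : ℤ) ∣ Eq 1 0 := ⟨((N / q : ℕ) : ℤ) * E 1 0, by
    rw [hEqdef, Matrix.smul_apply, smul_eq_mul]; push_cast; ring⟩
  obtain ⟨y, hy, hyι⟩ := (H _).mpr ⟨Eq, hMEq, rfl⟩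
  change y ∈ X.O₀ at hy
  change X.ι y = _ at hyι
  refine ⟨1, X.isOrder.one_mem, y, hy, X.ι_injective ?_⟩
  have hγq : (γ : Matrix (Fin 2) (Fin 2) ℤ) = 1 + (q : ℤ) • Eq := by
    rw [hγE, hEqdef, smul_smul]
    congr 2
    have : q * (M * (N / q)) = M * N := by
      rw [Nat.mul_left_comm, Nat.mul_div_cancel' hqN]
    exact_mod_cast this.symm
  have hmap : ((γ : Matrix (Fin 2) (Fin 2) ℤ).map (Int.cast : ℤ → ℝ)) = 1 + (q : ℤ) • Eq.map (Int.cast : ℤ → ℝ) := by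
    rw [hγq]
    change (Int.castRingHom ℝ).mapMatrix (1 + (q : ℤ) • Eq) = 1 + (q : ℤ) • (Int.castRingHom ℝ).mapMatrix Eq
    rw [map_add, map_one, map_zsmul]
  rw [map_sub, map_one, hx₀ι, hmap, map_zsmul, hyι, mul_add, add_mul, mul_one, Units.mul_inv, add_sub_cancel_left,
    mul_smul_comm, smul_mul_assoc]

/-- The entries of the real matrix of `T^n = (1 n; 0 1)`. [folklore] -/
private theorem mapGL_T_zpow_apply (n : ℤ) (i j : Fin 2) :
    (Matrix.SpecialLinearGroup.mapGL ℝ (ModularGroup.T ^ n)) i j = (((!![(1 : ℤ), n; 0, 1]) i j : ℤ) : ℝ) := by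
  have h1 : ((Matrix.SpecialLinearGroup.mapGL ℝ (ModularGroup.T ^ n)) : Matrix (Fin 2) (Fin 2) ℝ) =
      ((ModularGroup.T ^ n : SL(2, ℤ)) : Matrix (Fin 2) (Fin 2) ℤ).map (Int.cast : ℤ → ℝ) := by
    rw [Matrix.SpecialLinearGroup.mapGL_coe_matrix]; rfl
  rw [h1, ModularGroup.coe_T_zpow, Matrix.map_apply]

/-- The coercion `SL₂(ℤ) → GL₂(ℝ)` of the Möbius action is `mapGL ℝ`. [folklore] -/
private theorem coe_eq_mapGL (γ : SL(2, ℤ)) : (γ : GL (Fin 2) ℝ) = Matrix.SpecialLinearGroup.mapGL ℝ γ := rfl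

section Conj

variable {X} {A : GL (Fin 2) ℝ}
  (hconj : ∀ γ : SL(2, ℤ), γ ∈ CongruenceSubgroup.Gamma (M * ∏ q ∈ C, q) →
    ∃ x ∈ X.O, X.ι x = (A : Matrix (Fin 2) (Fin 2) ℝ) *
      ((γ : Matrix (Fin 2) (Fin 2) ℤ).map (Int.cast : ℤ → ℝ)) * ((A⁻¹ : GL (Fin 2) ℝ) : Matrix (Fin 2) (Fin 2) ℝ))
include hconj

/-- **`A·Γ(M·∏_C q)·A⁻¹ ≤ X.Gamma`** (`D = 1`). [cite: KohenPacetti2016, §2] -/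
theorem conj_mapGL_mem_Gamma {γ : SL(2, ℤ)} (hγ : γ ∈ CongruenceSubgroup.Gamma (M * ∏ q ∈ C, q)) :
    A * Matrix.SpecialLinearGroup.mapGL ℝ γ * A⁻¹ ∈ X.Gamma := by
  obtain ⟨x, hx, hxι⟩ := hconj γ hγ
  obtain ⟨y, hy, hyι⟩ := hconj γ⁻¹ (inv_mem hγ)
  refine ⟨⟨x, hx, ?_⟩, ⟨y, hy, ?_⟩, ?_⟩
  · rw [hxι, Units.val_mul, Units.val_mul, Matrix.SpecialLinearGroup.mapGL_coe_matrix]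
    rfl
  · have e : (A * Matrix.SpecialLinearGroup.mapGL ℝ γ * A⁻¹)⁻¹ = A * Matrix.SpecialLinearGroup.mapGL ℝ γ⁻¹ * A⁻¹ := by
      rw [map_inv]; group
    rw [e, hyι, Units.val_mul, Units.val_mul, Matrix.SpecialLinearGroup.mapGL_coe_matrix]
    rfl
  · rw [map_mul, map_mul, map_inv, mul_inv_cancel_comm, Matrix.SpecialLinearGroup.det_mapGL]

/-- **The translates `(A g)·∞`, `g ∈ SL₂(ℤ)`, are cusps of `X.Gamma`** (`D = 1`): the parabolic element
`A g T^{N'} g⁻¹ A⁻¹` (`N' = M ∏_C q`, `g T^{N'} g⁻¹ ∈ Γ(N')` by normality) lies in `X.Gamma` and fixes `(A g)·∞`.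
[cite: DiamondShurman2005, §2.4] -/
theorem isCusp_conj_smul_infty (hM : 0 < M) (g : SL(2, ℤ)) :
    IsCusp ((A * Matrix.SpecialLinearGroup.mapGL ℝ g) • (OnePoint.infty : OnePoint ℝ)) X.Gamma := by
  set N' : ℕ := M * ∏ q ∈ C, q with hN'def
  have hN' : N' ≠ 0 := Nat.mul_ne_zero hM.ne' X.prod_cartanPrimes_ne_zero
  have hT : ModularGroup.T ^ (N' : ℤ) ∈ CongruenceSubgroup.Gamma N' := by
    simpa using CongruenceSubgroup.ModularGroup_T_pow_mem_Gamma (N' : ℤ) (N' : ℤ) dvd_rfl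
  have hgT : g * ModularGroup.T ^ (N' : ℤ) * g⁻¹ ∈ CongruenceSubgroup.Gamma N' :=
    (CongruenceSubgroup.Gamma_normal N').conj_mem _ hT g
  refine ⟨A * Matrix.SpecialLinearGroup.mapGL ℝ (g * ModularGroup.T ^ (N' : ℤ) * g⁻¹) * A⁻¹,
    conj_mapGL_mem_Gamma hconj hgT, ?_, ?_⟩
  · have e : A * Matrix.SpecialLinearGroup.mapGL ℝ (g * ModularGroup.T ^ (N' : ℤ) * g⁻¹) * A⁻¹ =
        (A * Matrix.SpecialLinearGroup.mapGL ℝ g) * Matrix.SpecialLinearGroup.mapGL ℝ (ModularGroup.T ^ (N' : ℤ)) *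
          (A * Matrix.SpecialLinearGroup.mapGL ℝ g)⁻¹ := by
      rw [map_mul, map_mul, map_inv]; group
    rw [e, Matrix.GeneralLinearGroup.isParabolic_conj_iff]
    have h10 : (Matrix.SpecialLinearGroup.mapGL ℝ (ModularGroup.T ^ (N' : ℤ))) 1 0 = 0 := by
      rw [mapGL_T_zpow_apply]; simp
    rw [Matrix.GeneralLinearGroup.isParabolic_iff_of_upperTriangular h10]
    constructor
    · rw [mapGL_T_zpow_apply, mapGL_T_zpow_apply]; simp
    · rw [mapGL_T_zpow_apply]; simp [hN']
  · have e : A * Matrix.SpecialLinearGroup.mapGL ℝ (g * ModularGroup.T ^ (N' : ℤ) * g⁻¹) * A⁻¹ =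
        (A * Matrix.SpecialLinearGroup.mapGL ℝ g) * Matrix.SpecialLinearGroup.mapGL ℝ (ModularGroup.T ^ (N' : ℤ)) *
          (A * Matrix.SpecialLinearGroup.mapGL ℝ g)⁻¹ := by
      rw [map_mul, map_mul, map_inv]; group
    rw [e, mul_smul, mul_smul, inv_smul_smul]
    congr 1
    rw [OnePoint.smul_infty_eq_self_iff, mapGL_T_zpow_apply]
    simp

/-- **Translates of a cusp form on `X.Gamma` at the cusps are cuspidal `q`-series** (`D = 1`): for
`f ∈ S₂(X.Gamma)`... in any weight `k`, and `g ∈ SL₂(ℤ)`, `φ_g = f ∣[k] (A g)` is holomorphic, `N'`-periodic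
(`(A g) T^{N'} = P (A g)` with `P ∈ X.Gamma`) and tends to `0` at `i∞` (Mathlib `CuspFormClass.zero_at_cusps` at the
cusp `(A g)·∞`). [cite: DiamondShurman2005, §1.2 and §2.4] -/
theorem isCuspFunction_slash_conj (hM : 0 < M) {k : ℤ} (f : CuspForm X.Gamma k) (g : SL(2, ℤ)) :
    IsCuspFunction ((M * ∏ q ∈ C, q : ℕ) : ℝ) (⇑f ∣[k] (A * Matrix.SpecialLinearGroup.mapGL ℝ g)) := by
  set N' : ℕ := M * ∏ q ∈ C, q with hN'def
  have hN' : N' ≠ 0 := Nat.mul_ne_zero hM.ne' X.prod_cartanPrimes_ne_zero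
  set t : GL (Fin 2) ℝ := A * Matrix.SpecialLinearGroup.mapGL ℝ g with htdef
  have hT : ModularGroup.T ^ (N' : ℤ) ∈ CongruenceSubgroup.Gamma N' := by
    simpa using CongruenceSubgroup.ModularGroup_T_pow_mem_Gamma (N' : ℤ) (N' : ℤ) dvd_rfl
  have hP : t * Matrix.SpecialLinearGroup.mapGL ℝ (ModularGroup.T ^ (N' : ℤ)) * t⁻¹ ∈ X.Gamma := by
    have hgT : g * ModularGroup.T ^ (N' : ℤ) * g⁻¹ ∈ CongruenceSubgroup.Gamma N' :=
      (CongruenceSubgroup.Gamma_normal N').conj_mem _ hT g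
    have e : t * Matrix.SpecialLinearGroup.mapGL ℝ (ModularGroup.T ^ (N' : ℤ)) * t⁻¹ =
        A * Matrix.SpecialLinearGroup.mapGL ℝ (g * ModularGroup.T ^ (N' : ℤ) * g⁻¹) * A⁻¹ := by
      rw [htdef, map_mul, map_mul, map_inv]; group
    rw [e]; exact conj_mapGL_mem_Gamma hconj hgT
  -- slash invariance of `φ_g` under `T^{N'}`
  have hslash : (⇑f ∣[k] t) ∣[k] (ModularGroup.T ^ (N' : ℤ) : SL(2, ℤ)) = ⇑f ∣[k] t := by
    rw [ModularForm.SL_slash, ← SlashAction.slash_mul]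
    have e : t * (Matrix.SpecialLinearGroup.mapGL ℝ (ModularGroup.T ^ (N' : ℤ))) =
        (t * Matrix.SpecialLinearGroup.mapGL ℝ (ModularGroup.T ^ (N' : ℤ)) * t⁻¹) * t := by group
    change ⇑f ∣[k] (t * Matrix.SpecialLinearGroup.mapGL ℝ (ModularGroup.T ^ (N' : ℤ))) = _
    rw [e, SlashAction.slash_mul, SlashInvariantFormClass.slash_action_eq f _ hP]
  refine ⟨by exact_mod_cast Nat.pos_of_ne_zero hN', ?_, (CuspFormClass.holo f).slash k t, ?_⟩
  · -- periodicity
    intro w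
    simp only [comp_apply]
    push_cast
    by_cases hw : 0 < w.im
    · have hw' : 0 < (w + (N' : ℂ)).im := by simpa using hw
      have hTw : ModularGroup.T ^ (N' : ℤ) • ofComplex w = ofComplex (w + (N' : ℂ)) := by
        ext1
        rw [ModularGroup.coe_T_zpow_smul_eq, ofComplex_apply_of_im_pos hw, ofComplex_apply_of_im_pos hw']
        simp
      have := congr_fun hslash (ofComplex w)
      rw [ModularForm.SL_slash_apply, hTw] at this
      rw [← this]
      have hd : denom (ModularGroup.T ^ (N' : ℤ) : SL(2, ℤ)) (ofComplex w) = 1 := by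
        rw [ModularGroup.denom_apply, ModularGroup.coe_T_zpow]
        simp
      rw [hd, one_zpow, mul_one]
    · have hw' : (w + (N' : ℂ)).im ≤ 0 := by simpa using hw
      rw [ofComplex_apply_eq_of_im_nonpos hw' (not_lt.mp hw)]
  · -- zero at `i∞`: `t • ∞` is a cusp of `X.Gamma`
    exact CuspFormClass.zero_at_cusps f (isCusp_conj_smul_infty hconj hM g) t rfl

/-- **Reduction theory for `X.Gamma` (`D = 1`)**: `ℍ = X.Gamma · {A g : g ∈ R} · (𝒟_T ∪ {im > T})` for a finite
`R ⊆ SL₂(ℤ)` and every `T` (the tree's reduction for the finite-index subgroup `Γ(M∏q) ≤ SL₂(ℤ)`, transported by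
`A`). [cite: DiamondShurman2005, Lemma 2.3.1 and §2.4] -/
theorem exists_finset_reduction_of_discr_one (hM : 0 < M) :
    ∃ R : Finset SL(2, ℤ), ∀ (T : ℝ) (τ : ℍ), ∃ γ ∈ X.Gamma, ∃ g ∈ R, ∃ z : ℍ,
      τ = γ • (A * Matrix.SpecialLinearGroup.mapGL ℝ g) • z ∧
        (z ∈ ModularGroup.truncatedFundamentalDomain T ∨ T < z.im) := by
  set N' : ℕ := M * ∏ q ∈ C, q with hN'def
  have hN' : N' ≠ 0 := Nat.mul_ne_zero hM.ne' X.prod_cartanPrimes_ne_zero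
  haveI : NeZero N' := ⟨hN'⟩
  obtain ⟨R, hR⟩ := exists_finset_smul_truncatedFundamentalDomain_cover (CongruenceSubgroup.Gamma N')
  refine ⟨R, fun T τ => ?_⟩
  obtain ⟨γ, hγ, g, hg, z, hz, hz'⟩ := hR T (A⁻¹ • τ)
  refine ⟨A * Matrix.SpecialLinearGroup.mapGL ℝ γ * A⁻¹, conj_mapGL_mem_Gamma hconj hγ, g, hg, z, ?_, hz'⟩
  have e : τ = A • (γ • g • z) := by rw [← hz, smul_inv_smul]
  rw [e, ModularGroup.sl_moeb, ModularGroup.sl_moeb, coe_eq_mapGL, coe_eq_mapGL]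
  simp only [← mul_smul]
  congr 1
  group

/-- **The zeros of a non-zero cusp form on `X.Gamma` lie in finitely many orbits** (`D = 1`): every point is
`γ (A g) z` with `z` in the compact `𝒟_T` or of height `> T`; above height `T` no translate `f ∣[k] (A g)` vanishes
(`IsCuspFunction.exists_forall_ne_zero`), and the zeros in the compact `⋃_g (A g)·𝒟_T` are finitely many
(the finiteness of `∑_x ν_x(f)` in the valence formula, Diamond–Shurman §3.1). [cite: DiamondShurman2005, §3.1 (p. 65)] -/
theorem exists_finite_zeros_of_discr_one (hA : 0 < A.det.val) (hM : 0 < M) {k : ℤ} (f : CuspForm X.Gamma k)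
    (hf : (⇑f : ℍ → ℂ) ≠ 0) :
    ∃ F₀ : Set ℍ, F₀.Finite ∧ ∀ τ : ℍ, f τ = 0 → ∃ γ ∈ X.Gamma, γ • τ ∈ F₀ := by
  obtain ⟨R, hR⟩ := exists_finset_reduction_of_discr_one hconj hM
  have hMg : ∀ g ∈ R, ∀ᶠ T : ℝ in atTop, ∀ z : ℍ, T < z.im →
      (⇑f ∣[k] (A * Matrix.SpecialLinearGroup.mapGL ℝ g)) z ≠ 0 := by
    intro g _
    obtain ⟨T, hT⟩ := (isCuspFunction_slash_conj hconj hM f g).exists_forall_ne_zero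
      (slash_ne_zero_of_ne_zero hf _)
    filter_upwards [eventually_ge_atTop T] with T' hT' z hz
    exact hT z (hT'.trans hz.le)
  obtain ⟨T, hT⟩ := ((R.eventually_all).mpr hMg).exists
  set K : Set ℍ := ⋃ g ∈ R, (fun z : ℍ => (A * Matrix.SpecialLinearGroup.mapGL ℝ g) • z) ''
    ModularGroup.truncatedFundamentalDomain T with hKdef
  have hK : IsCompact K := R.isCompact_biUnion fun g _ =>
    (ModularGroup.isCompact_truncatedFundamentalDomain T).image (continuous_const_smul _)
  refine ⟨{τ | f τ = 0} ∩ K, finite_zeros_inter_of_isCompact (CuspFormClass.holo f) hf hK, fun τ hτ => ?_⟩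
  obtain ⟨γ, hγ, g, hg, z, rfl, hz⟩ := hR T τ
  have hdetγ : 0 < γ.det.val := by
    rw [Subgroup.HasDetOne.det_eq hγ]; exact one_pos
  have h1 : f ((A * Matrix.SpecialLinearGroup.mapGL ℝ g) • z) = 0 :=
    (cuspForm_apply_smul_eq_zero_iff f hγ hdetγ _).mp hτ
  rcases hz with hz | hz
  · refine ⟨γ⁻¹, inv_mem hγ, ?_⟩
    rw [inv_smul_smul]
    exact ⟨h1, mem_iUnion₂.mpr ⟨g, hg, z, hz, rfl⟩⟩
  · exfalso
    have hdet : 0 < (A * Matrix.SpecialLinearGroup.mapGL ℝ g).det.val := by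
      rw [map_mul, Matrix.SpecialLinearGroup.det_mapGL, mul_one]; exact hA
    exact hT g hg z hz ((slash_apply_eq_zero_iff (⇑f) hdet z).mpr h1)

/-- **The value of `Ψ = ∫_{τ₀}^τ f` at the cusp `(A g)·∞`** (`D = 1`): there is `C_g` with
`Ψ((A g) z) = C_g + (2πi)⁻¹ V_{φ_g}(z)`, `φ_g = f ∣[2] (A g)`, so `Ψ((A g) z) → C_g` uniformly as `im z → ∞`
(`∫_{(A g) z₁}^{(A g) z} f = ∫_{z₁}^{z} φ_g`, the `q`-expansion primitive `V_{φ_g}` and its uniform decay;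
Manin's `2πi∫_{i∞}^{gτ} f = C_g + V_{f|g}(τ)`). [cite: DiamondShurman2005, §2.4] [cite: FarkasKra1992, Prop. I.1.6] -/
theorem exists_cuspValue_of_discr_one (hA : 0 < A.det.val) (hM : 0 < M) (f : CuspForm X.Gamma 2) (τ₀ : ℍ)
    (g : SL(2, ℤ)) : ∃ Cg : ℂ, ∀ ε > 0, ∃ T : ℝ, ∀ z : ℍ, T ≤ z.im →
      ‖segmentIntegral f τ₀ ((A * Matrix.SpecialLinearGroup.mapGL ℝ g) • z) - Cg‖ < ε := by
  set t : GL (Fin 2) ℝ := A * Matrix.SpecialLinearGroup.mapGL ℝ g with htdef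
  have hdet : 0 < t.det.val := by
    rw [htdef, map_mul, Matrix.SpecialLinearGroup.det_mapGL, mul_one]; exact hA
  have hφ : IsCuspFunction ((M * ∏ q ∈ C, q : ℕ) : ℝ) (⇑f ∣[(2 : ℤ)] t) := isCuspFunction_slash_conj hconj hM f g
  have h2pi : (2 * Real.pi * Complex.I : ℂ) ≠ 0 := by simp [Real.pi_ne_zero]
  -- the primitive `V = (2πi)⁻¹ V_φ` of `φ = f ∣[2] t`
  set V : ℂ → ℂ := fun w => (2 * Real.pi * Complex.I)⁻¹ * verticalIntegral (⇑f ∣[(2 : ℤ)] t) (ofComplex w)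
    with hVdef
  have hV : ∀ w : ℂ, 0 < w.im → HasDerivAt V ((CuspForm.translate f t) (ofComplex w)) w := by
    intro w hw
    refine ((hφ.hasDerivAt_verticalIntegral hw).const_mul (2 * Real.pi * Complex.I)⁻¹).congr_deriv ?_
    rw [← mul_assoc, inv_mul_cancel₀ h2pi, one_mul]
    rfl
  have hseg : ∀ z : ℍ, segmentIntegral (⇑f ∣[(2 : ℤ)] t) UpperHalfPlane.I z = V z - V UpperHalfPlane.I :=
    fun z => segmentIntegral_eq_sub (CuspForm.translate f t) hV UpperHalfPlane.I z
  refine ⟨segmentIntegral f τ₀ (t • UpperHalfPlane.I) - V UpperHalfPlane.I, fun ε hε => ?_⟩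
  obtain ⟨T, hT⟩ := hφ.exists_forall_norm_verticalIntegral_le hε
  refine ⟨T, fun z hz => ?_⟩
  have e : segmentIntegral f τ₀ (t • z) - (segmentIntegral f τ₀ (t • UpperHalfPlane.I) - V UpperHalfPlane.I) = V z := by
    have h1 := segmentIntegral_sub_segmentIntegral f τ₀ (t • UpperHalfPlane.I) (t • z)
    have h2 := segmentIntegral_slash_eq f hdet UpperHalfPlane.I z
    rw [hseg] at h2
    linear_combination h1 - h2
  rw [e, hVdef]
  dsimp only
  rw [norm_mul, norm_inv]
  have hn : ‖(2 * Real.pi * Complex.I : ℂ)‖ = 2 * Real.pi := by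
    simp [Complex.norm_real, abs_of_pos Real.pi_pos]
  rw [hn, ofComplex_apply]
  have hpi : 1 < 2 * Real.pi := by linarith [Real.pi_gt_three]
  calc (2 * Real.pi)⁻¹ * ‖verticalIntegral (⇑f ∣[(2 : ℤ)] t) z‖ ≤ (2 * Real.pi)⁻¹ * ε := by
        gcongr; exact hT z hz
    _ < 1 * ε := by
        apply mul_lt_mul_of_pos_right _ hε
        exact inv_lt_one_of_one_lt₀ hpi
    _ = ε := one_mul ε

end Conj

/-- **Degree of a non-zero weight-two form on a Cartan-level MODULAR curve (`D = 1`)**: for `h ∈ S₂(X.Gamma)`,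
`h ≠ 0`, with periods in `Λ_L`, there is `d ≥ 1` such that all but finitely many classes of `ℂ∕Λ_L` are hit by
exactly `d` orbits `X.Gamma τ` under `τ ↦ ∫_{τ₀}^τ h` — Farkas–Kra for the compactification `X.Gamma∖ℍ*` at the
cusps, argued on `ℍ` (§1 with the cusp values `C_g`, §3). [cite: FarkasKra1992, Prop. I.1.6] [cite: DiamondShurman2005, §2.4 and §3.1 (p. 65)] -/
theorem exists_deg_of_hasPeriodsIn_of_discr_one (h : CuspForm X.Gamma 2) (hh : (⇑h : ℍ → ℂ) ≠ 0)
    (L : PeriodPair) (hper : HasPeriodsIn X.Gamma h (L.lattice : Set ℂ)) (τ₀ : ℍ) :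
    ∃ d : ℕ, 0 < d ∧
      {c : ℂ ⧸ L.lattice.toAddSubgroup |
        Nat.card {y : MulAction.orbitRel.Quotient X.Gamma ℍ // ∃ τ : ℍ,
          (Quotient.mk _ τ : MulAction.orbitRel.Quotient X.Gamma ℍ) = y ∧
            ((segmentIntegral h τ₀ τ : ℂ) : ℂ ⧸ L.lattice.toAddSubgroup) = c} ≠ d}.Finite := by
  classical
  haveI := X.properlyDiscontinuousSMul_Gamma
  obtain ⟨hM, A, hA, hconj⟩ := X.exists_conj_principal_of_discr_one
  obtain ⟨R, hR⟩ := exists_finset_reduction_of_discr_one hconj hM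
  set t : SL(2, ℤ) → GL (Fin 2) ℝ := fun g => A * Matrix.SpecialLinearGroup.mapGL ℝ g with htdef
  choose Cv hCv using fun g : SL(2, ℤ) => exists_cuspValue_of_discr_one hconj hA hM h τ₀ g
  have hCunif : ∀ ε > 0, ∃ T : ℝ, ∀ g ∈ R, ∀ z : ℍ, T ≤ z.im →
      ‖segmentIntegral h τ₀ (t g • z) - Cv g‖ < ε := by
    intro ε hε
    have : ∀ g ∈ R, ∀ᶠ T : ℝ in atTop, ∀ z : ℍ, T ≤ z.im → ‖segmentIntegral h τ₀ (t g • z) - Cv g‖ < ε := by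
      intro g _
      obtain ⟨T, hT⟩ := hCv g ε hε
      filter_upwards [eventually_ge_atTop T] with T' hT' z hz
      exact hT z (hT'.trans hz)
    exact ((R.eventually_all).mpr this).exists
  obtain ⟨F₀, hF₀, hZ⟩ := exists_finite_zeros_of_discr_one hconj hA hM h hh
  have hΨΓ : ∀ γ ∈ X.Gamma, ∀ τ : ℍ,
      segmentIntegral h τ₀ (γ • τ) - segmentIntegral h τ₀ τ ∈ L.lattice.toAddSubgroup := by
    intro γ hγ τ
    rw [segmentIntegral_sub_segmentIntegral h τ₀ τ (γ • τ)]
    exact hper γ hγ τ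
  refine exists_deg_of_fiberReduction h hh L hper τ₀ (R.finite_toSet.image Cv) (fun w₀ hw₀ => ?_) hF₀ hZ
  have hcusp : ∀ g ∈ R, Cv g - w₀ ∉ L.lattice.toAddSubgroup := by
    intro g hg hmem
    apply hw₀ (Cv g) ⟨g, hg, rfl⟩
    have := L.lattice.neg_mem hmem
    rwa [neg_sub] at this
  obtain ⟨T, hT⟩ := exists_eventually_forall_fiber_subset_translate R t hR hΨΓ L.isClosed_lattice Cv hCunif hcusp
  exact ⟨_, R.isCompact_biUnion fun g _ =>
    (ModularGroup.isCompact_truncatedFundamentalDomain T).image (continuous_const_smul _), hT⟩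

end CartanLevelCurveData

/-! ## §4 Every discriminant -/

/-- **DEGREE of a non-zero weight-two form with lattice periods on a Cartan-level Shimura curve, every `D`**:
for `X : CartanLevelCurveData D M C`, `h ∈ S₂(X.Gamma)` non-zero with periods in `Λ_L`, and `τ₀ ∈ ℍ`, there is
`d ≥ 1` such that for all but finitely many `c ∈ ℂ∕Λ_L` exactly `d` orbits `X.Gamma τ` have `∫_{τ₀}^τ h ≡ c`.
(`D = 0` is excluded by `Squarefree D`; `D = 1` is §3; `D > 1` is §2.) [cite: FarkasKra1992, Prop. I.1.6] -/
theorem CartanLevelCurveData.exists_deg_of_hasPeriodsIn {D M : ℕ} {C : Finset ℕ} (X : CartanLevelCurveData D M C)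
    (h : CuspForm X.Gamma 2) (hh : (⇑h : ℍ → ℂ) ≠ 0)
    (L : PeriodPair) (hper : HasPeriodsIn X.Gamma h (L.lattice : Set ℂ)) (τ₀ : ℍ) :
    ∃ d : ℕ, 0 < d ∧
      {c : ℂ ⧸ L.lattice.toAddSubgroup |
        Nat.card {y : MulAction.orbitRel.Quotient X.Gamma ℍ // ∃ τ : ℍ,
          (Quotient.mk _ τ : MulAction.orbitRel.Quotient X.Gamma ℍ) = y ∧
            ((segmentIntegral h τ₀ τ : ℂ) : ℂ ⧸ L.lattice.toAddSubgroup) = c} ≠ d}.Finite := by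
  rcases Nat.lt_trichotomy D 1 with hD | rfl | hD
  · exfalso
    have hD0 : D = 0 := by omega
    subst hD0
    exact not_squarefree_zero X.squarefree
  · exact X.exists_deg_of_hasPeriodsIn_of_discr_one h hh L hper τ₀
  · exact X.exists_deg_of_hasPeriodsIn_of_one_lt hD h hh L hper τ₀

end Literature.NumberTheory.Automorphic

end
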